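import Summits.QuantumFields.YangMills.Theorems.BalabanUVNodesN15DefectKernel
import Literature.MathematicalPhysics.QuantumFieldTheory.King1986.CovarianceRateTorus
import Literature.MathematicalPhysics.QuantumFieldTheory.Balaban1983to89.T4Cov2156Rate
import Literature.MathematicalPhysics.QuantumFieldTheory.Balaban1983to89.T4EtaRateSiteTorus
import HarnessLib

/-!
# Route «BalabanUVNodes» (K4 «SpineRates»), node N15 = NE2, THE -a ∕ -b INTERFACE OF THE BACKGROUND LAYER, part 3: THE UNIT-LATTICE FACTORS
# (identity pairing) IN BINDER (a)'s FORMAT — King's covariance `C^{(k)}` (Lemma 4.5), Bałaban's (2.156) covariance, the (1.66) entry kernels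

Cell `pub-ymgap`, seat `pub-ymgap-dag-n15-a` (KNIT-BY-NAME, generation g2; HUMAN RULING D-0062; chair R424 venue; `bears_on: R4∕N15`).  Filed
`--supports stmt-QuantumFields-19351` until the node stub `S_N15` of route «BalabanUVNodes» is an item.  THEOREMS ONLY; imports BY NAME, nothing
in the tree modified: part 1 `BalabanUVNodesN15DefectKernel` (this seat: `hasMaj_ofBlocks_of_entry_le`, `idef_single_apply`); `King1986.CovarianceRateTorus`
(cell `pub-balaban` template lineage: `king_lemma45_torus`, `K45`, `delta45`, `tdistT`, `effLaplacian`, `blockProj`); `T4Cov2156Rate` (seat t4-ne2-p3: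
`cov2156_rate_torus_king`) with `B6Cov2156Torus` (`bondReductionT`, `deltaPol`, `one_le_M`), `B6BondEliminationTorus.pdist`, `B6Lemma24Torus.pbox`;
`T4EtaRateSiteTorus` (pv25: `ksum166Family`, `C166T2`, `delta166T2`, `ksum166_step_bound_king` ⇐ `T4Rate166StripDirect.ksum_rate2_king`) with
`B6LowerBound2153Torus` (`toT`, `rep`, `toT_rep`), `B4TorusKernel.MultiPeriod.torusSupNorm`.

WHY.  Parts 1–2 typed the -a∕-b interface of N15's background layer (the η-defect `𝔇(G′,G) = G′τ₁ − τ₂G` in the block-majorant currency of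
`B11SectG`, binder (a) of n15-b's `idef_background_propagator_majorant`) and inhabited it with King's minimiser (unit lattice → fine lattice,
pull-back transport).  The factors of the `U ≡ 1` propagators that live on the UNIT lattice — the covariance `C^{(k)}` of the fluctuation integral
([Balaban1984PropagatorsII] (2.156) `C^{(k)}_Λ = C(C*Δ_kC)⁻¹C*`; King's `C^{(k)} = (Δ^{(k)} + aL⁻²Q*Q)⁻¹`, the middle factor of the single-scale
piece (4.42) `G_{(j)} = a²(GQ*)C^{(j)}(QG)`) and the unit-lattice operator `Δ_k` of [Balaban1984PropagatorsI] (1.66) — are compared across two runs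
by the IDENTITY pairing of unit-lattice sites (King p. 664; `T4EtaRateSiteOfRatePair` §1), which is HONEST for them (no collapse: both runs'
objects live on the same unit lattice).  For these the tree HOLDS kernel-proved η-rates: King's Lemma 4.5 on the torus (`king_lemma45_torus`), the
-a lineage's (2.156) rate (`cov2156_rate_torus_king`, the unit layer of the g0 knit `NE2NodeTorus`) and the (1.66) rate at King's exponent
(`ksum166_step_bound_king`, the operator layer of the g0 knit).  THIS FILE puts all three into binder (a)'s format BY NAME — the unit-lattice factor
defects n15-b's Leibniz bookkeeping (`T4EtaRateDefect.idef_comp_majorant`) consumes next to part 2's minimiser defect.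

THE PRINT (PROVED scalar statement + SHAPES; nothing of [B5]∕[B6]∕[B9] asserted beyond the cited tree theorems' own headers).  King, CMP **102**
(1986) Lemma 4.5 (4.38) p. 674 *«|C^{(k)}(x, y) − C^{(k+n)}(x, y)| ≤ CL^{−k}e^{−δ₀|x−y|}»* (tree `king_lemma45_torus`, periodic b.c., explicit
constants); [Balaban1984PropagatorsII] (2.156) p. 250 (object of `cov2156_rate_torus_king`, whose RATE is NOT printed — King-shape, kernel-proved
by the -a lineage); [Balaban1984PropagatorsI] (1.66) p. 29 (object of `ksum166_step_bound_king`, rate NOT printed — kernel-proved).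

CONTENTS.
* §1 GENERIC (identity pairing on one lattice `X`, sharp cubes of ANY site assignment `blk : X → 𝔅` with block count `n₀`):
  `idef_id_id_single_apply`, `mulVecLin_single_apply` (matrix entries), `idef_id_id_mulVecLin_single_apply` (`𝔇(A′,A)(δ_z)(x) = A′_{xz} − A_{xz}`);
  **`hasMaj_idef_id_id_of_rate`**: an entrywise rate `|A′(δ_z)(x) − A(δ_z)(x)| ≤ C·e^{−δ′t(x,z)}` in ANY lattice pseudo-distance `t` DOMINATING the
  carrier's, `δ·d(blk x, blk z) ≤ δ′·t(x,z)`, gives the block majorant `n₀·C·e^{−δd(y,y′)}` (flat weight: the rate factor `θ^k` sits in `C`).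
* §2 **`hasMaj_idef_kingCovariance`** ⇐ `king_lemma45_torus`: King's ACTUAL `A = 0` covariances `(Δ^{(k)} + aL⁻²Q*Q)⁻¹` vs `(Δ^{(k+n)} + aL⁻²Q*Q)⁻¹`
  on `Π ℤ∕(LM_μ)`: majorant `n₀·K₄₅L^{−k}·e^{−δd}` under `δ·d ≤ δ₄₅·tdist`.
* §3 **`hasMaj_idef_cov2156`** ⇐ `cov2156_rate_torus_king`: Bałaban's (2.156) bond covariances at `Δ_{k+m}` vs `Δ_k` on the unit torus
  (`L ∣ M_μ`, `d ≥ 2`): `∃ C′ δ′ > 0` (the cited theorem's), majorant `n₀·C′L^{−k}·e^{−δd}` under `δ·d ≤ δ′·ρ_M` — THE VECTOR unit layer of the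
  -a g0 knit in n15-b's currency.
* §4 **`hasMaj_idef_ksum166`** ⇐ `ksum166_step_bound_king`: the (1.66) torus entry kernels `Re K^{(L^k)}_{ab,N}` (`μ ≠ ν`) as convolution operators
  at levels `k + 1` vs `k`: majorant `n₀·C₁₆₆L^{−2k}·e^{−δd}` under `δ·d ≤ δ₁₆₆·|rep(x − z)|_{T,∞}` — the OPERATOR unit layer of the g0 knit.

HONEST FRAMING ∕ LIMITS.  MECHANISM + three CITED KERNEL THEOREMS re-packaged; the site assignment `blk`, the carrier `g` and the dominance
`δ·d ≤ δ′·t` are the consumer's (binders); §2 is King's scalar `A = 0` model, §3–§4 are the `U ≡ 1` Landau-gauge vector objects with rates that are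
NOT PRINTED but kernel-proved in the tree; nothing about `U ≠ 1`.  NE2⁺ NOT PRINTED ∕ not proved; count-neutral (typed 28∕28 · discharged unchanged);
NOT a discharge of N15; one finite T⁴ at fixed ε — NOT infinite volume, NOT OS on ℝ⁴, NOT a mass gap, NOT Clay.
-/

noncomputable section

namespace Summit.QuantumFields.YangMills.BalabanUVNodes.N15.DefectKernel

open Literature.MathematicalPhysics.QuantumFieldTheory.Balaban1983to89
open Literature.MathematicalPhysics.QuantumFieldTheory.Balaban1983to89.B11SectG (BlockNorm HasMaj)
open Literature.MathematicalPhysics.QuantumFieldTheory.Balaban1983to89.T4EtaRateDefect (idef)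
open Literature.MathematicalPhysics.QuantumFieldTheory.Balaban1983to89.T4EtaRateCoeffDefect (fibre)

/-! ## §1 Identity pairing on one lattice: matrix pairs with a rate in a dominating lattice distance -/

section Generic

variable {X : Type} [Fintype X] [DecidableEq X] {g : B6.Geometry}

omit [Fintype X] in
/-- Identity transports on both sides (both runs' objects on the SAME lattice): `𝔇(A′,A)(δ_z)(x) = A′(δ_z)(x) − A(δ_z)(x)`.
[cite: King1986, p.664 (identity pairing of unit-lattice sites across runs)] -/
theorem idef_id_id_single_apply (A' A : (X → ℝ) →ₗ[ℝ] (X → ℝ)) (z x : X) :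
    idef LinearMap.id LinearMap.id A' A (Pi.single z 1) x = A' (Pi.single z 1) x - A (Pi.single z 1) x := rfl

/-- The entries of a matrix as a linear map: `(A·δ_z)(x) = A_{xz}`. [folklore] -/
theorem mulVecLin_single_apply (A : Matrix X X ℝ) (z x : X) : Matrix.mulVecLin A (Pi.single z 1) x = A x z := by
  simp [Matrix.mulVec, dotProduct, Pi.single_apply]

/-- Matrix pair, identity transports: `𝔇(A′,A)(δ_z)(x) = A′_{xz} − A_{xz}`. [folklore] -/
theorem idef_id_id_mulVecLin_single_apply (A' A : Matrix X X ℝ) (z x : X) :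
    idef LinearMap.id LinearMap.id (Matrix.mulVecLin A') (Matrix.mulVecLin A) (Pi.single z 1) x = A' x z - A x z := by
  rw [idef_id_id_single_apply, mulVecLin_single_apply, mulVecLin_single_apply]

omit [Fintype X] [DecidableEq X] in
/-- DOMINANCE of the carrier distance by a lattice pseudo-distance transfers exponential decay. [folklore] -/
theorem exp_le_exp_of_dominates (blk : X → g.Site) {t : X → X → ℝ} {δ δ' : ℝ}
    (hdom : ∀ x z, δ * g.dist (blk x) (blk z) ≤ δ' * t x z) (x z : X) :
    Real.exp (-(δ' * t x z)) ≤ Real.exp (-(δ * g.dist (blk x) (blk z))) :=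
  Real.exp_le_exp.mpr (by linarith [hdom x z])

/-- **UNIT-LATTICE PAIR IN BINDER (a)'s FORMAT.**  Two operators on the same lattice (identity pairing) with an entrywise η-rate
`|A′(δ_z)(x) − A(δ_z)(x)| ≤ C·e^{−δ′t(x,z)}` in a lattice pseudo-distance `t` that DOMINATES the carrier distance of the site assignment
`blk` (`δ·d(blk x, blk z) ≤ δ′·t(x,z)`), at most `n₀` lattice points per cube: `𝔇(A′,A)` has the block majorant `n₀·C·e^{−δd(y,y′)}` between
the sharp cube norms (flat weight — the rate factor `θ^k` of a unit-lattice source is the constant inside `C`). [cite: King1986, Lemma 4.5 (4.38) p.674 (shape)] -/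
theorem hasMaj_idef_id_id_of_rate [DecidableEq g.Site] (blk : X → g.Site) {n₀ : ℕ} (hn₀ : ∀ y', (fibre blk y').card ≤ n₀)
    (A' A : (X → ℝ) →ₗ[ℝ] (X → ℝ)) {t : X → X → ℝ} {C δ δ' : ℝ} (hC : 0 ≤ C)
    (hdom : ∀ x z, δ * g.dist (blk x) (blk z) ≤ δ' * t x z)
    (h : ∀ x z, |A' (Pi.single z 1) x - A (Pi.single z 1) x| ≤ C * Real.exp (-(δ' * t x z))) :
    HasMaj (BlockNorm.ofBlocks g blk) (BlockNorm.ofBlocks g blk) (idef LinearMap.id LinearMap.id A' A)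
      (fun y y' => n₀ * C * Real.exp (-(δ * g.dist y y'))) := by
  have key := hasMaj_ofBlocks_of_entry_le blk blk (T := idef LinearMap.id LinearMap.id A' A)
    (κ := fun y y' => C * Real.exp (-(δ * g.dist y y'))) (fun _ _ => mul_nonneg hC (Real.exp_nonneg _)) hn₀
    fun x z => by
      rw [idef_id_id_single_apply]
      exact (h x z).trans (mul_le_mul_of_nonneg_left (exp_le_exp_of_dominates blk hdom x z) hC)
  exact key.mono fun y y' => le_of_eq (by ring)

/-- Matrix form of `hasMaj_idef_id_id_of_rate`. [folklore] -/
theorem hasMaj_idef_matrixPair_of_rate [DecidableEq g.Site] (blk : X → g.Site) {n₀ : ℕ}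
    (hn₀ : ∀ y', (fibre blk y').card ≤ n₀) (A' A : Matrix X X ℝ) {t : X → X → ℝ} {C δ δ' : ℝ} (hC : 0 ≤ C)
    (hdom : ∀ x z, δ * g.dist (blk x) (blk z) ≤ δ' * t x z)
    (h : ∀ x z, |A' x z - A x z| ≤ C * Real.exp (-(δ' * t x z))) :
    HasMaj (BlockNorm.ofBlocks g blk) (BlockNorm.ofBlocks g blk)
      (idef LinearMap.id LinearMap.id (Matrix.mulVecLin A') (Matrix.mulVecLin A))
      (fun y y' => n₀ * C * Real.exp (-(δ * g.dist y y'))) :=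
  hasMaj_idef_id_id_of_rate blk hn₀ _ _ hC hdom fun x z => by
    rw [mulVecLin_single_apply, mulVecLin_single_apply]
    exact h x z

end Generic

/-! ## §2 King's covariance `C^{(k)} = (Δ^{(k)} + aL⁻²Q*Q)⁻¹` (Lemma 4.5 (4.38)) — the scalar template of the unit-lattice covariance -/

section KingCovariance

open Literature.MathematicalPhysics.QuantumFieldTheory.Balaban1983to89.B5Prop11Plancherel (Tor fine)
open Literature.MathematicalPhysics.QuantumFieldTheory.King1986 (aK)
open Literature.MathematicalPhysics.QuantumFieldTheory.King1986.Torus (effLaplacian blockProj tdistT K45 delta45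
  king_lemma45_torus)

variable {d : ℕ}

/-- **KING'S LEMMA 4.5 IN BINDER (a)'s FORMAT.**  For King's ACTUAL `A = 0` unit-lattice covariances `C^{(k)} = (Δ^{(k)} + aL⁻²Q*Q)⁻¹` and
`C^{(k+n)}` on the torus `Π ℤ∕(LM_μ)` (`L ≥ 2`, `k, n ≥ 1`, `a, m² > 0`; tree `king_lemma45_torus`), identity pairing, and any site assignment
`blk` (block count `n₀`) whose carrier distance is dominated by King's torus distance, `δ·d(blk x, blk z) ≤ δ₄₅·tdist(x,z)`:
`𝔇(C^{(k+n)}, C^{(k)})` has the block majorant `n₀·K₄₅·L^{−k}·e^{−δd(y,y′)}`. [cite: King1986, Lemma 4.5 (4.38) p.674] -/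
theorem hasMaj_idef_kingCovariance {a m2 : ℝ} (ha : 0 < a) (hm : 0 < m2) {L k n : ℕ} [NeZero L] (hL : 2 ≤ L)
    (hk : 1 ≤ k) (hn : 1 ≤ n) (M : Fin d → ℕ) [∀ μ, NeZero (M μ)] {g : B6.Geometry} [DecidableEq g.Site]
    (blk : Tor (fine L M) → g.Site) {n₀ : ℕ} (hn₀ : ∀ y', (fibre blk y').card ≤ n₀) {δ : ℝ}
    (hdom : ∀ x z, δ * g.dist (blk x) (blk z) ≤ delta45 d a L * tdistT (fine L M) x z) :
    HasMaj (BlockNorm.ofBlocks g blk) (BlockNorm.ofBlocks g blk)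
      (idef LinearMap.id LinearMap.id
        (Matrix.mulVecLin (effLaplacian (L ^ n * L ^ k) (fine L M) (aK a L (k + n)) (((L ^ n * L ^ k : ℕ) : ℝ) ^ 2) m2
          + (a * ((L : ℝ) ^ 2)⁻¹) • blockProj L M)⁻¹)
        (Matrix.mulVecLin (effLaplacian (L ^ k) (fine L M) (aK a L k) (((L ^ k : ℕ) : ℝ) ^ 2) m2
          + (a * ((L : ℝ) ^ 2)⁻¹) • blockProj L M)⁻¹))
      (fun y y' => n₀ * (K45 d a L * ((L : ℝ) ^ k)⁻¹) * Real.exp (-(δ * g.dist y y'))) := by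
  have h1 := king_lemma45_torus (d := d) ha hm hL hk hn M
  have hK : 0 ≤ K45 d a L * ((L : ℝ) ^ k)⁻¹ := by
    obtain ⟨x⟩ : Nonempty (Tor (fine L M)) := ⟨0⟩
    have h0 := (abs_nonneg _).trans (h1 x x)
    have hE : 0 < Real.exp (-(delta45 d a L * tdistT (fine L M) x x)) := Real.exp_pos _
    nlinarith
  refine hasMaj_idef_matrixPair_of_rate blk hn₀ _ _ hK hdom fun x z => ?_
  rw [abs_sub_comm]
  exact h1 x z

end KingCovariance

/-! ## §3 Bałaban's (2.156) unit-lattice covariance `C^{(k)}_T = C(C*Δ_kC)⁻¹C*` — the VECTOR unit layer of the -a g0 knit -/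

section Cov2156

open Literature.MathematicalPhysics.QuantumFieldTheory.Balaban1983to89.B5Prop11Plancherel (Tor)
open Literature.MathematicalPhysics.QuantumFieldTheory.Balaban1983to89.B6Lemma24Torus (pbox)
open Literature.MathematicalPhysics.QuantumFieldTheory.Balaban1983to89.B6BondEliminationTorus (pdist)
open Literature.MathematicalPhysics.QuantumFieldTheory.Balaban1983to89.B6Cov2156Torus (deltaPol bondReductionT one_le_M)
open Literature.MathematicalPhysics.QuantumFieldTheory.Balaban1983to89.T4Cov2156Rate (cov2156_rate_torus_king)

variable {d : ℕ}

/-- **THE (2.156) UNIT LAYER IN BINDER (a)'s FORMAT** (the -a lineage's King-shape rate for Bałaban's Landau-gauge bond covariances,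
`T4Cov2156Rate.cov2156_rate_torus_king`, `d ≥ 2`, `L ≥ 1`): there are `C′, δ′ > 0` (the cited theorem's) such that on every unit torus
`Π ℤ∕M_μ` with `L ∣ M_μ`, for the covariances of `Δ_{k+m}` vs `Δ_k` (identity pairing of bonds) and any site assignment `blk` of the bonds
(block count `n₀`) dominated by the periodic distance, `δ·d(blk p, blk q) ≤ δ′·ρ_M(p,q)`: `𝔇(C^{(k+m)}, C^{(k)})` has the block majorant
`n₀·C′·L^{−k}·e^{−δd(y,y′)}`. [cite: Balaban1984PropagatorsII, (2.156) p.250 (object); King1986, Lemma 4.5 (4.38) p.674 (shape)] -/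
theorem hasMaj_idef_cov2156 (hd : 2 ≤ d) {L : ℕ} (hL : 1 ≤ L) :
    ∃ C' δ' : ℝ, 0 < C' ∧ 0 < δ' ∧
      ∀ (M : Fin d → ℕ) [∀ μ, NeZero (M μ)], (∀ i, L ∣ M i) → ∀ (k m : ℕ) {g : B6.Geometry} [DecidableEq g.Site]
        (blk : B4.Idx (pbox M) d → g.Site) {n₀ : ℕ}, (∀ y', (fibre blk y').card ≤ n₀) → ∀ {δ : ℝ},
        (∀ p q : B4.Idx (pbox M) d,
          δ * g.dist (blk p) (blk q) ≤ δ' * pdist M (one_le_M M) (p.1 : Fin d → ℤ) (q.1 : Fin d → ℤ)) →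
        HasMaj (BlockNorm.ofBlocks g blk) (BlockNorm.ofBlocks g blk)
          (idef LinearMap.id LinearMap.id
            (Matrix.mulVecLin (bondReductionT L M (deltaPol M (L ^ (k + m)))).cov)
            (Matrix.mulVecLin (bondReductionT L M (deltaPol M (L ^ k))).cov))
          (fun y y' => n₀ * (C' * ((L : ℝ) ^ k)⁻¹) * Real.exp (-(δ * g.dist y y'))) := by
  obtain ⟨C', δ', hC', hδ', H⟩ := cov2156_rate_torus_king (d := d) hd hL
  refine ⟨C', δ', hC', hδ', fun M _ hLM k m g _ blk n₀ hn₀ δ hdom => ?_⟩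
  exact hasMaj_idef_matrixPair_of_rate blk hn₀ _ _ (mul_nonneg hC'.le (inv_nonneg.mpr (pow_nonneg (Nat.cast_nonneg _) _)))
    hdom fun p q => H M hLM k m p q

end Cov2156

/-! ## §4 The (1.66) torus entry kernels `Re K^{(L^k)}_{ab,N}` at King's exponent — the OPERATOR unit layer of the -a g0 knit -/

section Ksum166

open Literature.MathematicalPhysics.QuantumFieldTheory.Balaban1983to89.B5Prop11Plancherel (Tor)
open Literature.MathematicalPhysics.QuantumFieldTheory.Balaban1983to89.B6LowerBound2153Torus (toT rep toT_rep)
open Literature.MathematicalPhysics.QuantumFieldTheory.Balaban1983to89.B4TorusKernel.MultiPeriod (torusSupNorm)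
open Literature.MathematicalPhysics.QuantumFieldTheory.Balaban1983to89.T4EtaRateSiteTorus (ksum166Family C166T2 delta166T2
  ksum166_step_bound_king)

variable {d : ℕ}

/-- **THE (1.66) UNIT LAYER IN BINDER (a)'s FORMAT** (`T4EtaRateSiteTorus.ksum166_step_bound_king` ⇐ `T4Rate166StripDirect.ksum_rate2_king`,
King's exponent `γ = 2`, every `L ≥ 1`, `μ ≠ ν`): two convolution operators on the unit torus `Tor N` whose entries are the (1.66) entry
kernels at levels `k + 1` and `k` (read off as binders `hA′`, `hA`), identity pairing, any site assignment `blk` (block count `n₀`) dominated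
by the torus sup-norm of the box representative, `δ·d(blk x, blk z) ≤ δ₁₆₆·|rep(x − z)|_{T,∞}`: `𝔇` has the block majorant
`n₀·C₁₆₆·(L^k)^{−2}·e^{−δd(y,y′)}`. [cite: Balaban1984PropagatorsI, (1.66) p.29 (object); King1986, Prop. 3.10 (3.91) p.669 (the exponent 2, shape)] -/
theorem hasMaj_idef_ksum166 (L : ℕ) [NeZero L] {μ ν : Fin (d + 1)} (hμν : μ ≠ ν) (a b : Fin (d + 1))
    (N : Fin (d + 1) → ℕ) [∀ i, NeZero (N i)] (k : ℕ) {g : B6.Geometry} [DecidableEq g.Site] (blk : Tor N → g.Site)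
    {n₀ : ℕ} (hn₀ : ∀ y', (fibre blk y').card ≤ n₀)
    (A' A : (Tor N → ℝ) →ₗ[ℝ] (Tor N → ℝ))
    (hA' : ∀ z x, A' (Pi.single z 1) x = ksum166Family L μ ν a b N (k + 1) (x - z))
    (hA : ∀ z x, A (Pi.single z 1) x = ksum166Family L μ ν a b N k (x - z)) {δ : ℝ}
    (hdom : ∀ x z, δ * g.dist (blk x) (blk z) ≤ delta166T2 d * torusSupNorm N (rep N (x - z))) :
    HasMaj (BlockNorm.ofBlocks g blk) (BlockNorm.ofBlocks g blk) (idef LinearMap.id LinearMap.id A' A)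
      (fun y y' => n₀ * (C166T2 d * ((L : ℝ) ^ k) ^ (-(2 : ℝ))) * Real.exp (-(δ * g.dist y y'))) := by
  have hrate : ∀ x z : Tor N, |A' (Pi.single z 1) x - A (Pi.single z 1) x| ≤
      C166T2 d * ((L : ℝ) ^ k) ^ (-(2 : ℝ)) * Real.exp (-(delta166T2 d * torusSupNorm N (rep N (x - z)))) := by
    intro x z
    have h := ksum166_step_bound_king L hμν a b N k (rep N (x - z))
    rw [toT_rep] at h
    rw [hA', hA]
    exact h
  have hC : 0 ≤ C166T2 d * ((L : ℝ) ^ k) ^ (-(2 : ℝ)) := by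
    obtain ⟨x⟩ : Nonempty (Tor N) := ⟨0⟩
    have h0 := (abs_nonneg _).trans (hrate x x)
    have hE : 0 < Real.exp (-(delta166T2 d * torusSupNorm N (rep N (x - x)))) := Real.exp_pos _
    nlinarith
  exact hasMaj_idef_id_id_of_rate blk hn₀ A' A hC hdom hrate

end Ksum166

end Summit.QuantumFields.YangMills.BalabanUVNodes.N15.DefectKernel
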